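import Literature.Analysis.FluidPDE.BoltzmannEquationProofs
import Mathlib.MeasureTheory.Measure.Haar.NormedSpace
import HarnessLib

/-!
# The dispersion decay `∫ e^{-a|ξ|²} e^{-b|Y - tξ|²} dξ ≤ C (1 + t)^{-d}` (CIP 1994 §4.5 (5.6))

Topic: MathematicalPhysics / KineticTheory. A brick of the convergence half of the named fact
`Literature.MathematicalPhysics.KineticTheory.illner_pulvirenti` (global validity of the
Boltzmann equation for a rare gas cloud in all space; Cercignani–Illner–Pulvirenti 1994
Thm 4.5.1; Illner–Pulvirenti 1986/1989): the time decay that makes the series solutions of the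
BBGKY and Boltzmann hierarchies converge GLOBALLY in time.

In Step 3 of the proof of CIP 1994 Thm 4.5.1 (pp. 88–90) each collision operator acting at
time `t` on a density dominated by the travelling Maxwellian costs, after the velocity moment
has been absorbed by the kinetic-energy weight ((5.5)), the factor ((5.6), Problem 4.5.1)

  `sup_Y ∫_{S^{d-1}} ∫_{ℝ^d} e^{-(β₀/2)|ξ|²} e^{-β₀ |Y + nσ - tξ|²} dn dξ ≤ C / (1 + t)^d`,

whose time integral over `[0, ∞)` is finite as soon as `d ≥ 2` — the ordered time integrals
then give `(∫₀^∞ C (1+τ)^{-d} dτ)ⁿ / n!` in place of Lanford's `(C t)ⁿ / n!` ((5.8)). This file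
proves the velocity integral behind (5.6) on a finite-dimensional real inner product space `E`
of dimension `D`:

* `integral_exp_neg_mul_sq_norm_sub_smul` — the exact scaling
  `∫ e^{-b|Y - tξ|²} dξ = t^{-D} ∫ e^{-b|u|²} du` for `t > 0`;
* `integral_exp_mul_exp_dispersion_le` — for `a, b > 0`, `t ≥ 0` and every `Y`,
  `∫ e^{-a|ξ|²} e^{-b|Y - tξ|²} dξ ≤ 2^D (G_a + G_b) / (1 + t)^D`, `G_c = ∫ e^{-c|u|²} du`
  (for `t ≤ 1` drop the second Gaussian, for `t ≥ 1` drop the first and scale).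

Theorems only; the Gaussian constants are left as the integrals `G_c` (finite, positive).

## References

* C. Cercignani, R. Illner, M. Pulvirenti, *The Mathematical Theory of Dilute Gases*, Applied
  Mathematical Sciences 106, Springer (1994), §4.5, proof of Thm 4.5.1, Step 3, (5.6) and
  Problem 1 p. 90.
* R. Illner, M. Pulvirenti, *Global validity of the Boltzmann equation for two- and
  three-dimensional rare gas in vacuum: erratum and improved result*, Comm. Math. Phys. 121
  (1989) 143–146.
-/

open MeasureTheory Real Set Filter Topology
open scoped InnerProductSpace

namespace Literature.MathematicalPhysics.KineticTheory

noncomputable section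

section Dispersion

variable {E : Type*} [NormedAddCommGroup E] [InnerProductSpace ℝ E] [FiniteDimensional ℝ E]
  [MeasurableSpace E] [BorelSpace E]

/-- Scaling of the travelling Gaussian: `∫ e^{-b|Y - tξ|²} dξ = t^{-D} ∫ e^{-b|u|²} du` for
`t > 0`, `D = dim E` (substitution `u = tξ - Y`: `Measure.integral_comp_smul` and translation
invariance). [folklore] -/
theorem integral_exp_neg_mul_sq_norm_sub_smul (b : ℝ) (Y : E) {t : ℝ} (ht : 0 < t) :
    ∫ ξ : E, exp (-b * ‖Y - t • ξ‖ ^ 2) =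
      (t ^ Module.finrank ℝ E)⁻¹ * ∫ u : E, exp (-b * ‖u‖ ^ 2) := by
  have h1 : (fun ξ : E => exp (-b * ‖Y - t • ξ‖ ^ 2)) =
      fun ξ : E => (fun u : E => exp (-b * ‖u - Y‖ ^ 2)) (t • ξ) := by
    funext ξ
    simp only [norm_sub_rev Y (t • ξ)]
  rw [h1, Measure.integral_comp_smul volume (fun u : E => exp (-b * ‖u - Y‖ ^ 2)) t]
  have h2 : (∫ u : E, exp (-b * ‖u - Y‖ ^ 2)) = ∫ u : E, exp (-b * ‖u‖ ^ 2) :=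
    integral_sub_right_eq_self (μ := (volume : Measure E)) (fun u : E => exp (-b * ‖u‖ ^ 2)) Y
  rw [h2, smul_eq_mul, abs_of_pos (inv_pos.2 (pow_pos ht _))]

/-- The travelling Gaussian `ξ ↦ e^{-b|Y - tξ|²}` is integrable for `b > 0`, `t ≠ 0`.
[folklore] -/
theorem integrable_exp_neg_mul_sq_norm_sub_smul {b : ℝ} (hb : 0 < b) (Y : E) {t : ℝ}
    (ht : t ≠ 0) : Integrable fun ξ : E => exp (-b * ‖Y - t • ξ‖ ^ 2) := by
  have h1 : Integrable fun u : E => exp (-b * ‖u - Y‖ ^ 2) :=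
    (Literature.Analysis.FluidPDE.integrable_exp_neg_mul_sq_norm hb).comp_sub_right Y
  have h2 : Integrable fun ξ : E => exp (-b * ‖t • ξ - Y‖ ^ 2) := h1.comp_smul ht
  refine h2.congr (Eventually.of_forall fun ξ => ?_)
  simp only [norm_sub_rev Y (t • ξ)]

/-- **The dispersion decay** (CIP 1994 §4.5 (5.6), Problem 4.5.1; Illner–Pulvirenti 1989):
for `a, b > 0`, `t ≥ 0` and every `Y ∈ E`,
`∫ e^{-a|ξ|²} e^{-b|Y - tξ|²} dξ ≤ 2^D (G_a + G_b) / (1 + t)^D`, where `D = dim E` and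
`G_c = ∫ e^{-c|u|²} du`. For `t ≤ 1` the second factor is dropped (`≤ G_a ≤ 2^D G_a/(1+t)^D`);
for `t ≥ 1` the first is dropped and the scaling `integral_exp_neg_mul_sq_norm_sub_smul` gives
`t^{-D} G_b ≤ 2^D G_b/(1+t)^D`. Its time integral is finite iff `D ≥ 2`, which is why the
rare-cloud theorem is stated in dimension `2` and `3`. [cite: CIP1994, §4.5 (5.6)] -/
theorem integral_exp_mul_exp_dispersion_le {a b : ℝ} (ha : 0 < a) (hb : 0 < b) (Y : E) {t : ℝ}
    (ht : 0 ≤ t) :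
    ∫ ξ : E, exp (-a * ‖ξ‖ ^ 2) * exp (-b * ‖Y - t • ξ‖ ^ 2) ≤
      2 ^ Module.finrank ℝ E *
          ((∫ u : E, exp (-a * ‖u‖ ^ 2)) + ∫ u : E, exp (-b * ‖u‖ ^ 2)) /
        (1 + t) ^ Module.finrank ℝ E := by
  set D : ℕ := Module.finrank ℝ E with hD
  set Ga : ℝ := ∫ u : E, exp (-a * ‖u‖ ^ 2) with hGa
  set Gb : ℝ := ∫ u : E, exp (-b * ‖u‖ ^ 2) with hGb
  have hGa0 : 0 ≤ Ga := integral_nonneg fun u => (exp_pos _).le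
  have hGb0 : 0 ≤ Gb := integral_nonneg fun u => (exp_pos _).le
  have h1t : 0 < 1 + t := by linarith
  have hpow : 0 < (1 + t) ^ D := pow_pos h1t D
  rw [le_div_iff₀ hpow]
  rcases le_total t 1 with ht1 | ht1
  · -- `t ≤ 1`: drop the travelling Gaussian
    have hI : ∫ ξ : E, exp (-a * ‖ξ‖ ^ 2) * exp (-b * ‖Y - t • ξ‖ ^ 2) ≤ Ga := by
      refine integral_mono_of_nonneg (Eventually.of_forall fun ξ => by positivity)
        (Literature.Analysis.FluidPDE.integrable_exp_neg_mul_sq_norm ha)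
        (Eventually.of_forall fun ξ => ?_)
      have h2 : exp (-b * ‖Y - t • ξ‖ ^ 2) ≤ 1 := exp_le_one_iff.2 (by nlinarith [sq_nonneg ‖Y - t • ξ‖])
      calc exp (-a * ‖ξ‖ ^ 2) * exp (-b * ‖Y - t • ξ‖ ^ 2) ≤ exp (-a * ‖ξ‖ ^ 2) * 1 :=
            mul_le_mul_of_nonneg_left h2 (exp_pos _).le
        _ = exp (-a * ‖ξ‖ ^ 2) := mul_one _
    have h2D : (1 + t) ^ D ≤ 2 ^ D := pow_le_pow_left₀ h1t.le (by linarith) D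
    calc (∫ ξ : E, exp (-a * ‖ξ‖ ^ 2) * exp (-b * ‖Y - t • ξ‖ ^ 2)) * (1 + t) ^ D
        ≤ Ga * 2 ^ D := mul_le_mul hI h2D hpow.le hGa0
      _ ≤ 2 ^ D * (Ga + Gb) := by nlinarith [pow_nonneg (zero_le_two (α := ℝ)) D]
  · -- `t ≥ 1`: drop the velocity Gaussian and scale
    have ht0 : 0 < t := by linarith
    have hI : ∫ ξ : E, exp (-a * ‖ξ‖ ^ 2) * exp (-b * ‖Y - t • ξ‖ ^ 2) ≤ (t ^ D)⁻¹ * Gb := by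
      rw [hGb, ← integral_exp_neg_mul_sq_norm_sub_smul b Y ht0]
      refine integral_mono_of_nonneg (Eventually.of_forall fun ξ => by positivity)
        (integrable_exp_neg_mul_sq_norm_sub_smul hb Y ht0.ne')
        (Eventually.of_forall fun ξ => ?_)
      have h2 : exp (-a * ‖ξ‖ ^ 2) ≤ 1 := exp_le_one_iff.2 (by nlinarith [sq_nonneg ‖ξ‖])
      calc exp (-a * ‖ξ‖ ^ 2) * exp (-b * ‖Y - t • ξ‖ ^ 2) ≤ 1 * exp (-b * ‖Y - t • ξ‖ ^ 2) :=
            mul_le_mul_of_nonneg_right h2 (exp_pos _).le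
        _ = exp (-b * ‖Y - t • ξ‖ ^ 2) := one_mul _
    have htD : 0 < t ^ D := pow_pos ht0 D
    have h2D : (1 + t) ^ D ≤ 2 ^ D * t ^ D := by
      rw [← mul_pow]
      exact pow_le_pow_left₀ h1t.le (by linarith) D
    calc (∫ ξ : E, exp (-a * ‖ξ‖ ^ 2) * exp (-b * ‖Y - t • ξ‖ ^ 2)) * (1 + t) ^ D
        ≤ ((t ^ D)⁻¹ * Gb) * (2 ^ D * t ^ D) :=
          mul_le_mul hI h2D hpow.le (mul_nonneg (inv_nonneg.2 htD.le) hGb0)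
      _ = 2 ^ D * Gb := by field_simp
      _ ≤ 2 ^ D * (Ga + Gb) := by nlinarith [pow_nonneg (zero_le_two (α := ℝ)) D]

end Dispersion

end

end Literature.MathematicalPhysics.KineticTheory
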